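import Literature.NumberTheory.Sieve.VaughanMeanValue
import Literature.NumberTheory.LFunctions.SiegelWalfisz
import HarnessLib

/-!
# parity.S27 — the Bombieri–Vinogradov theorem, PROVED

Topic `Literature/NumberTheory/Sieve`; sibling proofs file of `ParityWave0.lean`. This file closes
the named fact `Literature.NumberTheory.Sieve.bombieri_vinogradov` (parity.S27):

> for every `A` there are `B, C` such that for all large `x`,
> `∑_{q ≤ x^{1/2}(log x)^{-B}} max_{(a,q)=1} |ψ(y_q; q, a) − y_q/φ(q)| ≤ C x (log x)^{-A}`
> (Bombieri 1965; A. I. Vinogradov 1965; Huxley, *The distribution of prime numbers*, (24.2);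
> Iwaniec–Kowalski Thm. 17.1).

The proof assembles the tree's pieces:

* `Literature.NumberTheory.Sieve.bombieri_vinogradov_of_siegelWalfisz` (`VaughanMeanValue.lean`): Vaughan's mean
  value theorem for `ψ(x, χ)` over primitive characters (Vaughan 1980, Thm. 1; the large sieve of
  `LargeSieveInequality.lean` / `LargeSieveCharacters.lean`) reduces Bombieri–Vinogradov to the
  Siegel–Walfisz theorem (Davenport §28 / Cojocaru–Murty §9.2, `BombieriVinogradovReduction.lean`);
* `Literature.NumberTheory.LFunctions.siegel_walfisz_holds` (`Literature/NumberTheory/LFunctions/SiegelWalfisz.lean`):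
  the Siegel–Walfisz theorem, parity.S28 (Montgomery–Vaughan Cor. 11.19), from the zero-free
  region for Dirichlet `L`-functions (MV Thm. 11.3), Siegel's theorem (MV Thm. 11.14, Cor. 11.15)
  and Landau's contour method (MV Thm. 6.9 / 11.16).

## References

* E. Bombieri, *On the large sieve*, Mathematika 12 (1965), 201–225 (`Bombieri1965`).
* R. C. Vaughan, *An elementary method in prime number theory*, Acta Arith. 37 (1980), 111–115
  (`Vaughan1980`).
* H. L. Montgomery, R. C. Vaughan, *Multiplicative Number Theory I. Classical Theory*, CUP 2007,
  Cor. 11.19 (`MontgomeryVaughan2007`).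
-/

namespace Literature.NumberTheory.Sieve

/-- **parity.S27, the Bombieri–Vinogradov theorem, PROVED** (Bombieri 1965; A. I. Vinogradov
1965): `Literature.NumberTheory.Sieve.bombieri_vinogradov` holds — Vaughan's mean value theorem and the large sieve
reduce it to the Siegel–Walfisz theorem (`bombieri_vinogradov_of_siegelWalfisz`), which is
`siegel_walfisz_holds`. [cite: Bombieri1965] [cite: MontgomeryVaughan2007, Corollary 11.19] -/
theorem bombieri_vinogradov_holds : bombieri_vinogradov :=
  bombieri_vinogradov_of_siegelWalfisz LFunctions.siegel_walfisz_holds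

end Literature.NumberTheory.Sieve
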